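import Summits.HubbardSuperconductivity.HubbardSuperconductivity.Theses.IntrinsicLargeN
import Summits.HubbardSuperconductivity.HubbardSuperconductivity.Theorems.BalabanIRBirEveryGroundStateSchur

/-!
# Route `IntrinsicLargeN`, support `ReducedBCSEnergyGivesLRO` (item stmt-HubbardSuperconductivity-1660)

The three-line variational identity behind the reduced-BCS anchor of the route: for
`H_red = T − (g/L²)·Δ_dᴴΔ_d` (`T = hubbardTorus 2 L 1 0`, `Δ_d = pairField dWaveFormFactor L`) and a
normalised ground state `ψ` of `H_red` in the sector `szSector N 0`, an energy gain
`minE(H_red) + c ≤ minE(T)` on that sector forces `Re⟨ψ, Δ_dᴴΔ_d ψ⟩ ≥ L² c / g`: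
`E₀ = Re⟨ψ, H_red ψ⟩ = Re⟨ψ, T ψ⟩ − (g/L²) Re⟨ψ, Δ_dᴴΔ_d ψ⟩ ≥ minE(T) − (g/L²) X ≥ E₀ + c − (g/L²) X`.
Only the `sInf` definition of `Matrix.minEnergyOn` (variational principle in a sector) and the
eigen-equation of `IsGroundStateInSector` are used. Tasaki (2020) §2.1. [folklore]
-/

-- the mandated namespace `Summit.<Summit>.<Problem>.Theorems` repeats `HubbardSuperconductivity`
-- (single-problem summit, D-0017), which the `dupNamespace` linter flags on every declaration
set_option linter.dupNamespace false

namespace Summit.HubbardSuperconductivity.HubbardSuperconductivity.Theorems.IntrinsicLargeN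

open Matrix Literature.MathematicalPhysics.QuantumLattice

/-- Abstract core: if `ψ ∈ K` is a unit eigenvector of `T − κ•P` with eigenvalue
`minEnergyOn (T − κ•P) K`, `κ > 0`, and `minEnergyOn (T − κ•P) K + c ≤ minEnergyOn T K`, then
`c / κ ≤ Re⟨ψ, P ψ⟩` (variational principle for `T` tested on `ψ`). [folklore] -/
theorem div_le_re_expect_of_groundState_sub_smul {n : Type*} [Fintype n]
    (T P : Matrix n n ℂ) (K : Submodule ℂ (n → ℂ)) {κ c : ℝ} (hκ : 0 < κ) {ψ : n → ℂ}
    (hψK : ψ ∈ K) (hψ : star ψ ⬝ᵥ ψ = 1)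
    (heig : (T - (κ : ℂ) • P) *ᵥ ψ = (((T - (κ : ℂ) • P).minEnergyOn K : ℝ) : ℂ) • ψ)
    (hgap : (T - (κ : ℂ) • P).minEnergyOn K + c ≤ T.minEnergyOn K) :
    c / κ ≤ (star ψ ⬝ᵥ P *ᵥ ψ).re := by
  have hvar : T.minEnergyOn K ≤ (star ψ ⬝ᵥ T *ᵥ ψ).re :=
    Summit.HubbardSuperconductivity.HubbardSuperconductivity.Theorems.minEnergyOn_le_re_rayleigh
      T K hψK hψ
  have hE : star ψ ⬝ᵥ (T - (κ : ℂ) • P) *ᵥ ψ = (((T - (κ : ℂ) • P).minEnergyOn K : ℝ) : ℂ) := by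
    rw [heig, dotProduct_smul, hψ, smul_eq_mul, mul_one]
  have hsplit : star ψ ⬝ᵥ (T - (κ : ℂ) • P) *ᵥ ψ =
      star ψ ⬝ᵥ T *ᵥ ψ - (κ : ℂ) * (star ψ ⬝ᵥ P *ᵥ ψ) := by
    rw [sub_mulVec, dotProduct_sub, smul_mulVec, dotProduct_smul, smul_eq_mul]
  have hre : (star ψ ⬝ᵥ T *ᵥ ψ).re =
      (T - (κ : ℂ) • P).minEnergyOn K + κ * (star ψ ⬝ᵥ P *ᵥ ψ).re := by
    have h := congrArg Complex.re (hsplit.symm.trans hE)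
    rw [Complex.sub_re, Complex.re_ofReal_mul, Complex.ofReal_re] at h
    linarith
  rw [div_le_iff₀ hκ]
  nlinarith [hvar, hre, hgap]

/-- **`ReducedBCSEnergyGivesLRO`** (route `IntrinsicLargeN`, item stmt-HubbardSuperconductivity-1660):
an energy gain `c` of the reduced d-wave BCS Hamiltonian `T − (g/L²)Δ_dᴴΔ_d` over the free
hopping `T` on the sector `szSector N 0` gives every normalised sector ground state `ψ` the pair
coherence `Re⟨ψ, Δ_dᴴΔ_d ψ⟩ ≥ L² c / g`. [folklore] -/
theorem reducedBCSEnergyGivesLRO_proof :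
    Summit.HubbardSuperconductivity.HubbardSuperconductivity.Theses.IntrinsicLargeN.ReducedBCSEnergyGivesLRO := by
  intro g hg L _ N c ψ hψ hGS hgap
  obtain ⟨hK, -, heig⟩ := hGS
  have hL : (0 : ℝ) < (L : ℝ) ^ 2 := by
    have : (0 : ℝ) < (L : ℝ) := Nat.cast_pos.mpr (Nat.pos_of_ne_zero (NeZero.ne L))
    positivity
  have hκ : 0 < g / (L : ℝ) ^ 2 := div_pos hg hL
  have h := div_le_re_expect_of_groundState_sub_smul _ _ _ hκ hK hψ heig hgap
  have hrw : (L : ℝ) ^ 2 * c / g = c / (g / (L : ℝ) ^ 2) := by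
    field_simp
  rw [hrw]
  exact h

end Summit.HubbardSuperconductivity.HubbardSuperconductivity.Theorems.IntrinsicLargeN
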